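import Summits.CriticalPhenomena.PercolationContinuityZ3.Theorems.PercNearOneGluingNoHeavyLowerTailCILSetStarWitnesses
import Summits.CriticalPhenomena.PercolationContinuityZ3.Theorems.PercNearOneGluingNoHeavyLowerTailCILTwoGate
import Summits.CriticalPhenomena.PercolationContinuityZ3.Theorems.PercNearOneGluingNoHeavyLowerTailQuantitativeLonelierMember
import Summits.CriticalPhenomena.PercolationContinuityZ3.Theorems.PercNearOneGluingNoHeavyLowerTailCILInductionStep
import HarnessLib

/-!
# `NoHeavyLowerTail` (stmt-CriticalPhenomena-4575) — the crux from the QI certificate ("QI-coverage ⇒ STEP ⇒ CIL ⇒ crux")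

Support file (prover `prim-hp-5`, hull-port cell, blob-quotient technique; `--supports stmt-CriticalPhenomena-4575`).
No definitions, no named facts, no sorries.

The STEP of the induction on positive pairs (`Theorems.setCS_of_step`, `Theorems.noHeavyLowerTail_of_step`, file
`…CILInductionStep`) asks for set-champion stability `CS_w(S, c)` of a light non-relay set `S` (`|S| ≥ 2`) at a non-adjacent
champion `c`, given CS for the champions of every weight function of smaller measure.  The QI socket
(`CutObserver.SetStar.setCS_of_classDeficiencies`, file `…CILSetStarDeficiencies`) derives `CS_w(S, c)` from a per-gate-class
certificate: a reference relay `x_Y` for every class `Y` with a slack `d(Y)`, and the averaged inequality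
`q(∅)·I_K(c) + Σ_Y q(Y)·(J^Y(c) − J^Y(x_Y) − d(Y)) ≥ 0`.  Two kinds of slack are PROVED:
* `d(Y) = 0` when `x_Y` is a champion of `K = w^S` (`w` switched off on the pairs meeting `S`): `CS_K(Y, x_Y)` is the induction
  hypothesis when `Y` is disjoint from `A` (classes `Y ∈ 𝒥` below) or the lonely-cluster exchange when `Y` meets `A`;
* `d(Y) = (I_K(y_Y) − I_K(x_Y))⁺` for ANY member `y_Y ∈ Y` and any `x_Y ∈ A` (quantitative lonelier-member lemma, `…QuantitativeLonelierMember`).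

* `noHeavyLowerTail_of_QI` — **if every STEP instance admits such a certificate ("QI-coverage"), the crux `NoHeavyLowerTail` holds.**
  The hypothesis `hQI` is the inequality `B_QI ≥ 0` of the crux notes of `prim-hp-5` written out: for every
  `(n, w, A, S, c, j)` as in the STEP there are maps `x, y` and a family `𝒥` of classes (those certified by a champion of `K`)
  with `x_Y ∈ A`, `y_Y ∈ Y`, `x_Y` a champion of `K` for `Y ∈ 𝒥`, and the averaged inequality (sum over all `Y`; classes that
  are not gate sets have weight `q(Y) = 0`).

Numerics (this seat; lab/bqi*.py, kit j047230, ttrl request `qi-coverage-step-certificate`): the certificate with, per class, the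
best of all references (B_QI) is `≥ 0` on every published ≥3-gate counterexample to the bounded-depth reference rules
B0/B1/B2/(ML*)/FR (BLOBQUOTIENT.md §17–§21) and in ≈ 1 000 random + 80 adversarially climbed instances (n ≤ 9), where it tracks
the true margin `Λ` to within `10⁻³` at the adversarial frontier.  `hQI` is NOT proved here.
-/

noncomputable section

namespace Summit.CriticalPhenomena.PercolationContinuityZ3.Theorems

open MeasureTheory Set Literature.Probability.LatticeModels Literature.Probability.Percolation
open scoped Classical BigOperators

namespace CutObserver

namespace SetStar

variable {n : ℕ}

open TwoGate in
/-- (Private copy of `SetStar.setCS_of_classDeficiencies` of `…CILSetStarDeficiencies`, whose module was not yet built on the farm when this file was checked.) **Set-champion stability from per-gate-class references WITH DEFICIENCIES.**  As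
`SetStar.setCS_of_classWitnesses`, but the reference relay `x_Y` of a class need only satisfy `CS_K(Y, x_Y)` up to an additive
slack `d(Y)` (`ℓ_Y(x_Y) ≤ r_Y(x_Y) + d(Y)`), which is then subtracted in the averaged inequality:
`q(∅)·I_K(c) + Σ_{∅ ≠ Y ∈ 𝒴} q(Y)·(J^Y(c) − J^Y(x_Y) − d(Y)) ≥ 0` implies `CS_w(S, c)`.  The slack of a class is supplied,
for ANY reference relay, by the quantitative lonelier-member lemma (`setCS_of_classMembers` below). [folklore] -/
private theorem setCS_of_classDeficiencies' (w : Sym2 (Fin n) → unitInterval) (A S : Finset (Fin n)) (c : Fin n) (j : ℕ)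
    (hSA : Disjoint S A) (hcA : c ∈ A) (𝒴 : Finset (Finset (Fin n)))
    (h𝒴 : (prodBernoulli w).real
      {ω : BondConfig (Fin n) | (Finset.univ.filter fun u => u ∉ S ∧ ∃ v ∈ S, s(u, v) ∈ ω) ∉ 𝒴} = 0)
    (x : Finset (Fin n) → Fin n) (hxA : ∀ Y ∈ 𝒴, x Y ∈ A) (d : Finset (Fin n) → ℝ)
    (hW : ∀ Y ∈ 𝒴, Y.Nonempty →
      (prodBernoulli w).real {ω : BondConfig (Fin n) |
          (∀ u ∈ Y, ¬ (openGraph (ω ∩ {e | ∀ v ∈ S, v ∉ e})).Reachable (x Y) u) ∧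
            1 ≤ (A.filter fun b => ∃ u ∈ Y, (openGraph (ω ∩ {e | ∀ v ∈ S, v ∉ e})).Reachable u b).card ∧
            (A.filter fun b => ∃ u ∈ Y, (openGraph (ω ∩ {e | ∀ v ∈ S, v ∉ e})).Reachable u b).card ≤ j} ≤
        (prodBernoulli w).real {ω : BondConfig (Fin n) |
          (∀ u ∈ Y, ¬ (openGraph (ω ∩ {e | ∀ v ∈ S, v ∉ e})).Reachable (x Y) u) ∧
            (A.filter fun b => (openGraph (ω ∩ {e | ∀ v ∈ S, v ∉ e})).Reachable (x Y) b).card ≤ j} + d Y)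
    (havg : 0 ≤ ∑ Y ∈ 𝒴,
      (prodBernoulli w).real
          {ω : BondConfig (Fin n) | (Finset.univ.filter fun u => u ∉ S ∧ ∃ v ∈ S, s(u, v) ∈ ω) = Y} *
        (if Y = ∅ then
          (prodBernoulli w).real {ω : BondConfig (Fin n) |
            (A.filter fun b => (openGraph (ω ∩ {e | ∀ v ∈ S, v ∉ e})).Reachable c b).card ≤ j}
         else
          (((prodBernoulli w).real {ω : BondConfig (Fin n) |
              (∀ u ∈ Y, ¬ (openGraph (ω ∩ {e | ∀ v ∈ S, v ∉ e})).Reachable c u) ∧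
                (A.filter fun b => (openGraph (ω ∩ {e | ∀ v ∈ S, v ∉ e})).Reachable c b).card ≤ j} +
            (prodBernoulli w).real {ω : BondConfig (Fin n) |
              (∃ u ∈ Y, (openGraph (ω ∩ {e | ∀ v ∈ S, v ∉ e})).Reachable c u) ∧
                (A.filter fun b => ∃ u ∈ Y, (openGraph (ω ∩ {e | ∀ v ∈ S, v ∉ e})).Reachable u b).card ≤ j}) -
          ((prodBernoulli w).real {ω : BondConfig (Fin n) |
              (∀ u ∈ Y, ¬ (openGraph (ω ∩ {e | ∀ v ∈ S, v ∉ e})).Reachable (x Y) u) ∧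
                (A.filter fun b => (openGraph (ω ∩ {e | ∀ v ∈ S, v ∉ e})).Reachable (x Y) b).card ≤ j} +
            (prodBernoulli w).real {ω : BondConfig (Fin n) |
              (∃ u ∈ Y, (openGraph (ω ∩ {e | ∀ v ∈ S, v ∉ e})).Reachable (x Y) u) ∧
                (A.filter fun b => ∃ u ∈ Y, (openGraph (ω ∩ {e | ∀ v ∈ S, v ∉ e})).Reachable u b).card ≤ j}) -
            d Y)))
    : (prodBernoulli w).real {ω : BondConfig (Fin n) | (∀ y ∈ S, ω ∉ openConn c y) ∧
        1 ≤ (A.filter fun b => ∃ y ∈ S, ω ∈ openConn y b).card ∧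
        (A.filter fun b => ∃ y ∈ S, ω ∈ openConn y b).card ≤ j} ≤
      (prodBernoulli w).real {ω : BondConfig (Fin n) | (∀ y ∈ S, ω ∉ openConn c y) ∧
        (A.filter fun b => ω ∈ openConn c b).card ≤ j} := by
  haveI : IsProbabilityMeasure (prodBernoulli w) := inferInstance
  set μ := prodBernoulli w with hμ
  have hcS : c ∉ S := fun h => Finset.disjoint_left.1 hSA h hcA
  set LS := {ω : BondConfig (Fin n) | (∀ y ∈ S, ω ∉ openConn c y) ∧
    1 ≤ (A.filter fun b => ∃ y ∈ S, ω ∈ openConn y b).card ∧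
    (A.filter fun b => ∃ y ∈ S, ω ∈ openConn y b).card ≤ j} with hLS
  set RS := {ω : BondConfig (Fin n) | (∀ y ∈ S, ω ∉ openConn c y) ∧
    (A.filter fun b => ω ∈ openConn c b).card ≤ j} with hRS
  set q : Finset (Fin n) → ℝ := fun Y =>
    μ.real {ω : BondConfig (Fin n) | (Finset.univ.filter fun u => u ∉ S ∧ ∃ v ∈ S, s(u, v) ∈ ω) = Y} with hq
  set ℓ : Finset (Fin n) → Fin n → ℝ := fun Y t => μ.real {ω : BondConfig (Fin n) |
    (∀ u ∈ Y, ¬ (openGraph (ω ∩ {e | ∀ v ∈ S, v ∉ e})).Reachable t u) ∧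
      1 ≤ (A.filter fun b => ∃ u ∈ Y, (openGraph (ω ∩ {e | ∀ v ∈ S, v ∉ e})).Reachable u b).card ∧
      (A.filter fun b => ∃ u ∈ Y, (openGraph (ω ∩ {e | ∀ v ∈ S, v ∉ e})).Reachable u b).card ≤ j} with hℓ
  set r : Finset (Fin n) → Fin n → ℝ := fun Y t => μ.real {ω : BondConfig (Fin n) |
    (∀ u ∈ Y, ¬ (openGraph (ω ∩ {e | ∀ v ∈ S, v ∉ e})).Reachable t u) ∧
      (A.filter fun b => (openGraph (ω ∩ {e | ∀ v ∈ S, v ∉ e})).Reachable t b).card ≤ j} with hr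
  set bb : Finset (Fin n) → Fin n → ℝ := fun Y t => μ.real {ω : BondConfig (Fin n) |
    (∃ u ∈ Y, (openGraph (ω ∩ {e | ∀ v ∈ S, v ∉ e})).Reachable t u) ∧
      (A.filter fun b => ∃ u ∈ Y, (openGraph (ω ∩ {e | ∀ v ∈ S, v ∉ e})).Reachable u b).card ≤ j} with hbb
  set bad : Finset (Fin n) → ℝ := fun Y => μ.real {ω : BondConfig (Fin n) |
    1 ≤ (A.filter fun b => ∃ u ∈ Y, (openGraph (ω ∩ {e | ∀ v ∈ S, v ∉ e})).Reachable u b).card ∧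
      (A.filter fun b => ∃ u ∈ Y, (openGraph (ω ∩ {e | ∀ v ∈ S, v ∉ e})).Reachable u b).card ≤ j} with hbad
  set IK : Fin n → ℝ := fun t => μ.real {ω : BondConfig (Fin n) |
    (A.filter fun b => (openGraph (ω ∩ {e | ∀ v ∈ S, v ∉ e})).Reachable t b).card ≤ j} with hIK
  -- flat expansions
  have hL : μ.real LS = ∑ Y ∈ 𝒴, q Y * ℓ Y c := setL_eq_sum w A S c j hSA hcS 𝒴 h𝒴
  have hR : μ.real RS = ∑ Y ∈ 𝒴, q Y * r Y c := setR_eq_sum w A S c j hcS 𝒴 h𝒴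
  -- the per-class gain
  set g : Finset (Fin n) → ℝ := fun Y =>
    if Y = ∅ then IK c else (r Y c + bb Y c) - (r Y (x Y) + bb Y (x Y)) - d Y with hg
  have havg' : 0 ≤ ∑ Y ∈ 𝒴, q Y * g Y := havg
  -- bookkeeping
  have hshift : ∀ Y, ∀ t ∈ A, ℓ Y t + bb Y t = bad Y := fun Y t ht =>
    setL_add_near w A Y {e | ∀ v ∈ S, v ∉ e} ht j
  have hℓ0 : ∀ t, ℓ ∅ t = 0 := fun t => setL_empty w A {e | ∀ v ∈ S, v ∉ e} t j
  have hr0 : ∀ t, r ∅ t = IK t := fun t => setR_empty w A {e | ∀ v ∈ S, v ∉ e} t j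
  -- each class term dominates the gain
  have hterm : ∀ Y ∈ 𝒴, g Y ≤ r Y c - ℓ Y c := by
    intro Y hY
    by_cases hY0 : Y = ∅
    · rw [hY0, hℓ0, hr0]
      simp only [hg, if_true]
      linarith
    · have hne : Y.Nonempty := Finset.nonempty_iff_ne_empty.2 hY0
      have e1 := hshift Y c hcA
      have e2 := hshift Y (x Y) (hxA Y hY)
      have hWY : ℓ Y (x Y) ≤ r Y (x Y) + d Y := hW Y hY hne
      simp only [hg, hY0, if_false]
      linarith
  have hq0 : ∀ Y ∈ 𝒴, 0 ≤ q Y := fun Y _ => measureReal_nonneg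
  have hsum : ∑ Y ∈ 𝒴, q Y * ℓ Y c ≤ ∑ Y ∈ 𝒴, q Y * r Y c := by
    have h1 : ∑ Y ∈ 𝒴, q Y * g Y ≤ ∑ Y ∈ 𝒴, q Y * (r Y c - ℓ Y c) :=
      Finset.sum_le_sum fun Y hY => mul_le_mul_of_nonneg_left (hterm Y hY) (hq0 Y hY)
    have h2 : ∑ Y ∈ 𝒴, q Y * (r Y c - ℓ Y c) = ∑ Y ∈ 𝒴, q Y * r Y c - ∑ Y ∈ 𝒴, q Y * ℓ Y c := by
      rw [← Finset.sum_sub_distrib]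
      exact Finset.sum_congr rfl fun Y _ => by ring
    linarith
  exact (hL.trans_le hsum).trans_eq hR.symm

end SetStar

end CutObserver

open CutObserver CutObserver.TwoGate in
/-- **QLM slack of one gate class (ξ-form).**  For a vertex set `Y`, a member `y ∈ Y` and any vertex `x`, in the
configuration off `S`: `ℓ_Y(x) ≤ r_Y(x) + max (I_K(y) − I_K(x)) 0` — `CutObserver.observerSet_le_add_posPart` for the weight
function switched off on the pairs meeting `S`, transferred by `TwoGate.measureReal_preimage_off`.
[cite: VandenbergHaggstromKahn2005, Thm. 1.5 (p. 7) — via CutObserver.observerSet_le_add_posPart] -/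
theorem qlm_classSlack {n : ℕ} (w : Sym2 (Fin n) → unitInterval) (A S : Finset (Fin n)) (j : ℕ)
    (Y : Finset (Fin n)) (x y : Fin n) (hy : y ∈ Y) :
    (prodBernoulli w).real {ω : BondConfig (Fin n) |
        (∀ u ∈ Y, ¬ (openGraph (ω ∩ {e | ∀ v ∈ S, v ∉ e})).Reachable x u) ∧
          1 ≤ (A.filter fun b => ∃ u ∈ Y, (openGraph (ω ∩ {e | ∀ v ∈ S, v ∉ e})).Reachable u b).card ∧
          (A.filter fun b => ∃ u ∈ Y, (openGraph (ω ∩ {e | ∀ v ∈ S, v ∉ e})).Reachable u b).card ≤ j} ≤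
      (prodBernoulli w).real {ω : BondConfig (Fin n) |
        (∀ u ∈ Y, ¬ (openGraph (ω ∩ {e | ∀ v ∈ S, v ∉ e})).Reachable x u) ∧
          (A.filter fun b => (openGraph (ω ∩ {e | ∀ v ∈ S, v ∉ e})).Reachable x b).card ≤ j} +
      max ((prodBernoulli w).real {ω : BondConfig (Fin n) | (A.filter fun b => (openGraph (ω ∩ {e | ∀ v ∈ S, v ∉ e})).Reachable y b).card ≤ j} -
        (prodBernoulli w).real {ω : BondConfig (Fin n) | (A.filter fun b => (openGraph (ω ∩ {e | ∀ v ∈ S, v ∉ e})).Reachable x b).card ≤ j}) 0 := by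
  set D : Set (Sym2 (Fin n)) := {e | ∀ v ∈ S, v ∉ e} with hD
  set w' : Sym2 (Fin n) → unitInterval := fun e => if e ∈ D then w e else 0 with hw'
  have hI : ∀ t : Fin n,
      (prodBernoulli w).real {ω : BondConfig (Fin n) |
          (A.filter fun b => (openGraph (ω ∩ {e | ∀ v ∈ S, v ∉ e})).Reachable t b).card ≤ j} =
        (prodBernoulli w').real {ω : BondConfig (Fin n) | (A.filter fun b => ω ∈ openConn t b).card ≤ j} := by
    intro t
    have h := measureReal_preimage_off w D
      {ω : BondConfig (Fin n) | (A.filter fun b => ω ∈ openConn t b).card ≤ j}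
    have hset : {ω : BondConfig (Fin n) | ω ∩ D ∈
        {ω : BondConfig (Fin n) | (A.filter fun b => ω ∈ openConn t b).card ≤ j}} =
        {ω : BondConfig (Fin n) |
          (A.filter fun b => (openGraph (ω ∩ {e | ∀ v ∈ S, v ∉ e})).Reachable t b).card ≤ j} := by
      ext ω; simp only [hD, mem_setOf_eq, mem_openConn_iff']
    rw [hset] at h
    exact h
  have key := observerSet_le_add_posPart w' A Y y x hy j
  have hL := measureReal_preimage_off w D
    {ω : BondConfig (Fin n) | (∀ u ∈ Y, ω ∉ openConn x u) ∧
      1 ≤ (A.filter fun b => ∃ u ∈ Y, ω ∈ openConn u b).card ∧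
      (A.filter fun b => ∃ u ∈ Y, ω ∈ openConn u b).card ≤ j}
  have hsetL : {ω : BondConfig (Fin n) | ω ∩ D ∈
      {ω : BondConfig (Fin n) | (∀ u ∈ Y, ω ∉ openConn x u) ∧
        1 ≤ (A.filter fun b => ∃ u ∈ Y, ω ∈ openConn u b).card ∧
        (A.filter fun b => ∃ u ∈ Y, ω ∈ openConn u b).card ≤ j}} =
      {ω : BondConfig (Fin n) |
        (∀ u ∈ Y, ¬ (openGraph (ω ∩ {e | ∀ v ∈ S, v ∉ e})).Reachable x u) ∧
          1 ≤ (A.filter fun b => ∃ u ∈ Y, (openGraph (ω ∩ {e | ∀ v ∈ S, v ∉ e})).Reachable u b).card ∧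
          (A.filter fun b => ∃ u ∈ Y, (openGraph (ω ∩ {e | ∀ v ∈ S, v ∉ e})).Reachable u b).card ≤ j} := by
    ext ω; simp only [hD, mem_setOf_eq, mem_openConn_iff']
  rw [hsetL] at hL
  have hR := measureReal_preimage_off w D
    {ω : BondConfig (Fin n) | (∀ u ∈ Y, ω ∉ openConn x u) ∧ (A.filter fun b => ω ∈ openConn x b).card ≤ j}
  have hsetR : {ω : BondConfig (Fin n) | ω ∩ D ∈
      {ω : BondConfig (Fin n) | (∀ u ∈ Y, ω ∉ openConn x u) ∧
        (A.filter fun b => ω ∈ openConn x b).card ≤ j}} =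
      {ω : BondConfig (Fin n) |
        (∀ u ∈ Y, ¬ (openGraph (ω ∩ {e | ∀ v ∈ S, v ∉ e})).Reachable x u) ∧
          (A.filter fun b => (openGraph (ω ∩ {e | ∀ v ∈ S, v ∉ e})).Reachable x b).card ≤ j} := by
    ext ω; simp only [hD, mem_setOf_eq, mem_openConn_iff']
  rw [hsetR] at hR
  rw [hL, hR, hI y, hI x]
  convert key using 3

open CutObserver CutObserver.SetStar CutObserver.TwoGate in
/-- **QI-coverage ⇒ `NoHeavyLowerTail`.**  See the file header for the shape of `hQI` (per-class references `x`, members `y`,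
champion-certified classes `𝒥`, averaged inequality).  Proof: `noHeavyLowerTail_of_step` with the STEP discharged by
`SetStar.setCS_of_classDeficiencies`; the slack-`0` classes use the induction hypothesis (or the lonely-cluster exchange when the
class meets `A`) in the switched-off graph `w^S`, of smaller measure; the other classes use `CutObserver.observerSet_le_add_posPart`.
[cite: VandenbergHaggstromKahn2005, Thm. 1.5 (p. 7)] -/
theorem noHeavyLowerTail_of_QI
    (hQI : ∀ (n : ℕ) (w : Sym2 (Fin n) → unitInterval) (A S : Finset (Fin n)) (c : Fin n) (j : ℕ),
      Disjoint S A → 2 ≤ S.card → c ∈ A →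
      (∀ a ∈ A, (prodBernoulli w).real {ω : BondConfig (Fin n) | (A.filter fun z => ω ∈ openConn a z).card ≤ j} ≤
        (prodBernoulli w).real {ω : BondConfig (Fin n) | (A.filter fun z => ω ∈ openConn c z).card ≤ j}) →
      (∀ v ∈ S, (prodBernoulli w).real {ω : BondConfig (Fin n) | (A.filter fun z => ω ∈ openConn c z).card ≤ j} <
        (prodBernoulli w).real {ω : BondConfig (Fin n) | (A.filter fun z => ω ∈ openConn v z).card ≤ j}) →
      (∃ v ∈ S, ∃ y, y ∉ S ∧ w s(v, y) ≠ 0) →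
      (∀ v ∈ S, w s(c, v) = 0) →
      ∃ (x y : Finset (Fin n) → Fin n) (𝒥 : Finset (Finset (Fin n))),
        (∀ Y, x Y ∈ A) ∧ (∀ Y : Finset (Fin n), Y.Nonempty → y Y ∈ Y) ∧
        (∀ Y ∈ 𝒥, ∀ a ∈ A, (prodBernoulli w).real {ω : BondConfig (Fin n) | (A.filter fun b => (openGraph (ω ∩ {e | ∀ v ∈ S, v ∉ e})).Reachable a b).card ≤ j} ≤
          (prodBernoulli w).real {ω : BondConfig (Fin n) | (A.filter fun b => (openGraph (ω ∩ {e | ∀ v ∈ S, v ∉ e})).Reachable (x Y) b).card ≤ j}) ∧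
        0 ≤ ∑ Y ∈ (Finset.univ : Finset (Fin n)).powerset,
          (prodBernoulli w).real {ω : BondConfig (Fin n) | (Finset.univ.filter fun u => u ∉ S ∧ ∃ v ∈ S, s(u, v) ∈ ω) = Y} *
          (if Y = ∅ then (prodBernoulli w).real {ω : BondConfig (Fin n) | (A.filter fun b => (openGraph (ω ∩ {e | ∀ v ∈ S, v ∉ e})).Reachable c b).card ≤ j}
           else (((prodBernoulli w).real {ω : BondConfig (Fin n) | (∀ u ∈ Y, ¬ (openGraph (ω ∩ {e | ∀ v ∈ S, v ∉ e})).Reachable c u) ∧ (A.filter fun b => (openGraph (ω ∩ {e | ∀ v ∈ S, v ∉ e})).Reachable c b).card ≤ j} +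
              (prodBernoulli w).real {ω : BondConfig (Fin n) | (∃ u ∈ Y, (openGraph (ω ∩ {e | ∀ v ∈ S, v ∉ e})).Reachable c u) ∧ (A.filter fun b => ∃ u ∈ Y, (openGraph (ω ∩ {e | ∀ v ∈ S, v ∉ e})).Reachable u b).card ≤ j}) -
             ((prodBernoulli w).real {ω : BondConfig (Fin n) | (∀ u ∈ Y, ¬ (openGraph (ω ∩ {e | ∀ v ∈ S, v ∉ e})).Reachable (x Y) u) ∧ (A.filter fun b => (openGraph (ω ∩ {e | ∀ v ∈ S, v ∉ e})).Reachable (x Y) b).card ≤ j} +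
              (prodBernoulli w).real {ω : BondConfig (Fin n) | (∃ u ∈ Y, (openGraph (ω ∩ {e | ∀ v ∈ S, v ∉ e})).Reachable (x Y) u) ∧ (A.filter fun b => ∃ u ∈ Y, (openGraph (ω ∩ {e | ∀ v ∈ S, v ∉ e})).Reachable u b).card ≤ j}) -
             (if Y ∈ 𝒥 then (0 : ℝ) else
               max ((prodBernoulli w).real {ω : BondConfig (Fin n) | (A.filter fun b => (openGraph (ω ∩ {e | ∀ v ∈ S, v ∉ e})).Reachable (y Y) b).card ≤ j} -
                 (prodBernoulli w).real {ω : BondConfig (Fin n) | (A.filter fun b => (openGraph (ω ∩ {e | ∀ v ∈ S, v ∉ e})).Reachable (x Y) b).card ≤ j}) 0)))) :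
    Summit.CriticalPhenomena.PercolationContinuityZ3.Theses.PercNearOneGluing.NoHeavyLowerTail := by
  refine noHeavyLowerTail_of_step ?_
  intro n w A S c j hSA hS2 hcA hchamp hlight hout hnonadj ih
  obtain ⟨x, y, 𝒥, hxA, hyY, h𝒥, havg⟩ := hQI n w A S c j hSA hS2 hcA hchamp hlight hout hnonadj
  -- the weight function switched off on the pairs meeting `S`, and its smaller measure
  obtain ⟨v₀, hv₀S, u₀, -, hwu₀⟩ := hout
  have he₀D : s(v₀, u₀) ∉ {e : Sym2 (Fin n) | ∀ v ∈ S, v ∉ e} := fun h => h v₀ hv₀S (Sym2.mem_mk_left v₀ u₀)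
  have hnz : (Finset.univ.filter fun e => (fun e => if e ∈ {e : Sym2 (Fin n) | ∀ v ∈ S, v ∉ e} then w e else 0) e ≠ 0) ⊆
      (Finset.univ.filter fun e => w e ≠ 0).erase s(v₀, u₀) := by
    intro e he
    rw [Finset.mem_filter] at he
    rw [Finset.mem_erase, Finset.mem_filter]
    by_cases heD : e ∈ {e : Sym2 (Fin n) | ∀ v ∈ S, v ∉ e}
    · simp only [heD, if_true] at he
      exact ⟨fun h => he₀D (h ▸ heD), Finset.mem_univ _, he.2⟩
    · simp [heD] at he
  have hfr : (Finset.univ.filter fun e =>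
        (fun e => if e ∈ {e : Sym2 (Fin n) | ∀ v ∈ S, v ∉ e} then w e else 0) e ≠ 0 ∧
          (fun e => if e ∈ {e : Sym2 (Fin n) | ∀ v ∈ S, v ∉ e} then w e else 0) e ≠ 1) ⊆
      (Finset.univ.filter fun e => w e ≠ 0 ∧ w e ≠ 1) := by
    intro e he
    rw [Finset.mem_filter] at he ⊢
    by_cases heD : e ∈ {e : Sym2 (Fin n) | ∀ v ∈ S, v ∉ e}
    · simp only [heD, if_true] at he
      exact ⟨Finset.mem_univ _, he.2⟩
    · simp [heD] at he
  have hlt : (Fintype.card (Sym2 (Fin n)) + 1) *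
        (Finset.univ.filter fun e =>
          (fun e => if e ∈ {e : Sym2 (Fin n) | ∀ v ∈ S, v ∉ e} then w e else 0) e ≠ 0).card +
        (Finset.univ.filter fun e =>
          (fun e => if e ∈ {e : Sym2 (Fin n) | ∀ v ∈ S, v ∉ e} then w e else 0) e ≠ 0 ∧
            (fun e => if e ∈ {e : Sym2 (Fin n) | ∀ v ∈ S, v ∉ e} then w e else 0) e ≠ 1).card <
      (Fintype.card (Sym2 (Fin n)) + 1) * (Finset.univ.filter fun e => w e ≠ 0).card +
        (Finset.univ.filter fun e => w e ≠ 0 ∧ w e ≠ 1).card := by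
    have h1 := Finset.card_le_card hnz
    have hmem : s(v₀, u₀) ∈ (Finset.univ.filter fun e => w e ≠ 0) :=
      Finset.mem_filter.2 ⟨Finset.mem_univ _, hwu₀⟩
    rw [Finset.card_erase_of_mem hmem] at h1
    have hpos := Finset.card_pos.2 ⟨_, hmem⟩
    have h2 := Finset.card_le_card hfr
    have h3 : (Finset.univ.filter fun e =>
        (fun e => if e ∈ {e : Sym2 (Fin n) | ∀ v ∈ S, v ∉ e} then w e else 0) e ≠ 0).card + 1 ≤
        (Finset.univ.filter fun e => w e ≠ 0).card := by
      omega
    have h4 := Nat.mul_le_mul_left (Fintype.card (Sym2 (Fin n)) + 1) h3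
    rw [Nat.mul_add, Nat.mul_one] at h4
    generalize hP : (Fintype.card (Sym2 (Fin n)) + 1) * (Finset.univ.filter fun e =>
        (fun e => if e ∈ {e : Sym2 (Fin n) | ∀ v ∈ S, v ∉ e} then w e else 0) e ≠ 0).card = P at h4 ⊢
    generalize hQ : (Fintype.card (Sym2 (Fin n)) + 1) * (Finset.univ.filter fun e => w e ≠ 0).card = Q at h4 ⊢
    omega
  -- transfer of the lightness events to the switched-off weight function
  have hI : ∀ t : Fin n,
      (prodBernoulli w).real {ω : BondConfig (Fin n) |
          (A.filter fun b => (openGraph (ω ∩ {e | ∀ v ∈ S, v ∉ e})).Reachable t b).card ≤ j} =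
        (prodBernoulli fun e => if e ∈ {e : Sym2 (Fin n) | ∀ v ∈ S, v ∉ e} then w e else 0).real
          {ω : BondConfig (Fin n) | (A.filter fun b => ω ∈ openConn t b).card ≤ j} := by
    intro t
    have h := measureReal_preimage_off w {e : Sym2 (Fin n) | ∀ v ∈ S, v ∉ e}
      {ω : BondConfig (Fin n) | (A.filter fun b => ω ∈ openConn t b).card ≤ j}
    have hset : {ω : BondConfig (Fin n) | ω ∩ {e : Sym2 (Fin n) | ∀ v ∈ S, v ∉ e} ∈
        {ω : BondConfig (Fin n) | (A.filter fun b => ω ∈ openConn t b).card ≤ j}} =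
        {ω : BondConfig (Fin n) |
          (A.filter fun b => (openGraph (ω ∩ {e | ∀ v ∈ S, v ∉ e})).Reachable t b).card ≤ j} := by
      ext ω; simp only [mem_setOf_eq, mem_openConn_iff']
    rw [hset] at h
    exact h
  -- the socket
  refine setCS_of_classDeficiencies' w A S c j hSA hcA (Finset.univ : Finset (Fin n)).powerset ?_ x (fun Y _ => hxA Y)
    (fun Y => if Y ∈ 𝒥 then (0 : ℝ) else
      max ((prodBernoulli w).real {ω : BondConfig (Fin n) | (A.filter fun b => (openGraph (ω ∩ {e | ∀ v ∈ S, v ∉ e})).Reachable (y Y) b).card ≤ j} -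
        (prodBernoulli w).real {ω : BondConfig (Fin n) | (A.filter fun b => (openGraph (ω ∩ {e | ∀ v ∈ S, v ∉ e})).Reachable (x Y) b).card ≤ j}) 0) ?_ havg
  · -- every gate set lies in the full powerset
    have h0 : {ω : BondConfig (Fin n) | (Finset.univ.filter fun u => u ∉ S ∧ ∃ v ∈ S, s(u, v) ∈ ω) ∉
        (Finset.univ : Finset (Fin n)).powerset} = ∅ := by
      ext ω
      simp only [mem_setOf_eq, mem_empty_iff_false, iff_false, not_not, Finset.mem_powerset]
      exact Finset.subset_univ _
    rw [h0, measureReal_empty]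
  · intro Y _ hne
    by_cases hYJ : Y ∈ 𝒥
    · -- slack 0: `x Y` is a champion of `K`
      simp only [hYJ, if_true, add_zero]
      have hxmax' : ∀ a ∈ A,
          (prodBernoulli fun e => if e ∈ {e : Sym2 (Fin n) | ∀ v ∈ S, v ∉ e} then w e else 0).real
              {ω : BondConfig (Fin n) | (A.filter fun b => ω ∈ openConn a b).card ≤ j} ≤
            (prodBernoulli fun e => if e ∈ {e : Sym2 (Fin n) | ∀ v ∈ S, v ∉ e} then w e else 0).real
              {ω : BondConfig (Fin n) | (A.filter fun b => ω ∈ openConn (x Y) b).card ≤ j} := by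
        intro a ha
        rw [← hI a, ← hI (x Y)]
        exact h𝒥 Y hYJ a ha
      have hL := measureReal_preimage_off w {e : Sym2 (Fin n) | ∀ v ∈ S, v ∉ e}
        {ω : BondConfig (Fin n) | (∀ u ∈ Y, ω ∉ openConn (x Y) u) ∧
          1 ≤ (A.filter fun b => ∃ u ∈ Y, ω ∈ openConn u b).card ∧
          (A.filter fun b => ∃ u ∈ Y, ω ∈ openConn u b).card ≤ j}
      have hsetL : {ω : BondConfig (Fin n) | ω ∩ {e : Sym2 (Fin n) | ∀ v ∈ S, v ∉ e} ∈
          {ω : BondConfig (Fin n) | (∀ u ∈ Y, ω ∉ openConn (x Y) u) ∧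
            1 ≤ (A.filter fun b => ∃ u ∈ Y, ω ∈ openConn u b).card ∧
            (A.filter fun b => ∃ u ∈ Y, ω ∈ openConn u b).card ≤ j}} =
          {ω : BondConfig (Fin n) |
            (∀ u ∈ Y, ¬ (openGraph (ω ∩ {e | ∀ v ∈ S, v ∉ e})).Reachable (x Y) u) ∧
              1 ≤ (A.filter fun b => ∃ u ∈ Y, (openGraph (ω ∩ {e | ∀ v ∈ S, v ∉ e})).Reachable u b).card ∧
              (A.filter fun b => ∃ u ∈ Y, (openGraph (ω ∩ {e | ∀ v ∈ S, v ∉ e})).Reachable u b).card ≤ j} := by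
        ext ω; simp only [mem_setOf_eq, mem_openConn_iff']
      rw [hsetL] at hL
      have hR := measureReal_preimage_off w {e : Sym2 (Fin n) | ∀ v ∈ S, v ∉ e}
        {ω : BondConfig (Fin n) | (∀ u ∈ Y, ω ∉ openConn (x Y) u) ∧ (A.filter fun b => ω ∈ openConn (x Y) b).card ≤ j}
      have hsetR : {ω : BondConfig (Fin n) | ω ∩ {e : Sym2 (Fin n) | ∀ v ∈ S, v ∉ e} ∈
          {ω : BondConfig (Fin n) | (∀ u ∈ Y, ω ∉ openConn (x Y) u) ∧ (A.filter fun b => ω ∈ openConn (x Y) b).card ≤ j}} =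
          {ω : BondConfig (Fin n) |
            (∀ u ∈ Y, ¬ (openGraph (ω ∩ {e | ∀ v ∈ S, v ∉ e})).Reachable (x Y) u) ∧
              (A.filter fun b => (openGraph (ω ∩ {e | ∀ v ∈ S, v ∉ e})).Reachable (x Y) b).card ≤ j} := by
        ext ω; simp only [mem_setOf_eq, mem_openConn_iff']
      rw [hsetR] at hR
      rw [hL, hR]
      by_cases hYA : Disjoint Y A
      · exact ih _ hlt Y (x Y) hYA hne (hxA Y) hxmax'
      · rw [Finset.not_disjoint_iff] at hYA
        obtain ⟨a, haY, haA⟩ := hYA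
        convert observerSet_le_of_lonelier (fun e => if e ∈ {e : Sym2 (Fin n) | ∀ v ∈ S, v ∉ e} then w e else 0)
          A Y a (x Y) haY j (hxmax' a haA) using 12
    · -- QLM slack
      simp only [hYJ, if_false]
      exact qlm_classSlack w A S j Y (x Y) (y Y) (hyY Y hne)

end Summit.CriticalPhenomena.PercolationContinuityZ3.Theorems

end
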